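import Literature.Combinatorics.VectorBalancingPartition
import Mathlib.Analysis.InnerProductSpace.PiL2
import HarnessLib

/-!
# Booker–Thorne 2014, Proposition 10, in abstract form: well-conditioned class matrices

Sibling of `DavenportHeilbronnDegreeTwo.lean` (barrier catalogue, D-0021), part of the proof of
`Literature.Barriers.RiemannHypothesis.BookerThorne2014_levelOne_zeros` /
`BookerThorne2014_thm1_levelOne` along the printed architecture; everything here is PROVED, there
are no definitions and no named facts.

A. R. Booker, F. Thorne, *Zeros of `L`-functions outside the critical strip*, Algebra Number
Theory 8 (2014), §3, **Proposition 10**: "There is a compact set `K ⊆ GL_n(ℂ)` … depending only on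
the degrees `r_1, …, r_n`, with the following property: Let `m` be a positive integer. Then there
are real numbers `Y > 1` and `δ > 0` such that for any `y ≥ Y` and `σ ∈ (1, 1 + δ/log y]`, there
exists a partition of `S(y)` into `mn` pairwise disjoint subsets `S_{ik}(y)` and a choice of
`ε_p ∈ S¹` for each `p ∈ S(y)`, such that the `m`-tuple of matrices
`g_i = ((mn/s(y,σ)) ∑_{p ∈ S_{ik}(y)} ε_p λ_j(p) p^{-σ})_{1 ≤ j,k ≤ n}` lies in `K^m`."

This file proves the linear-algebra-and-combinatorics content of the proposition for ABSTRACT data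
(`abstract_prop10`): a finite window `Pw` of indices ("primes `y < p ≤ P`") with masses `ω_p ≥ 0`
("`p^{-σ}`", total `s₀`) and vectors `Λ_p ∈ ℂⁿ` ("`(λ_j(p))_j`", `‖Λ_p‖ ≤ r`, `r = 2√n` under
Ramanujan) whose Gram form is large on unit vectors ("Lemma 3": `∑ ω_p |⟨u,Λ_p⟩|² ≥ s₀/4`) and
whose atoms are small (`64 M n W₀ ≤ s₀`, `W₀² ≥ ∑ ω_p² (1 + ‖Λ_p‖⁴)`). Output: `M = |J|·n` classes
`cls : ℕ → J × Fin n`, unimodular phases `ε_p`, and the matrices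
`G_x = ((M/s₀) ∑_{cls p = (x,k)} ε_p ω_p Λ_p(i))_{i,k}`, all in the compact set
`K(A,b) = {‖g z‖_∞ ≤ A‖z‖_∞, ‖g z‖_∞ ≥ b‖z‖_∞}`, `A = 3nr`, `b = (16r(1+48r²)^{n−1}√n)⁻¹` —
the input format of the tree's `BookerThorne2014.prop9` (`DavenportHeilbronnDegreeTwoBTProp9.lean`).
The analytic inputs (the prime number theorem for `s(y,σ) → ∞`, Lemma 3, the Ramanujan bound) are
supplied by the consumer (`…BTProp8.lean`).

Proof as printed, with one substitution: the residue classes `S_{ik}(y)` (which in print need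
Lemma 3 in arithmetic progressions) are replaced by the fair classes of
`Literature.Combinatorics.VectorBalancing.exists_fair_partition` applied to the atoms
`(ω_p, ω_p Λ_p(i) conj Λ_p(j))` (`exists_fair_gram_classes`; "it is likely that this could be
avoided at the expense of making the proof more complicated", §1, Remarks); the inductive choice
of the phases along Gram–Schmidt directions is `exists_adaptive_columns` ("we choose `ε_p` such
that `ε_p(ū_1λ_1(p)+…+ū_nλ_n(p))` is real and nonnegative"), and the passage from the Gram–Schmidt
lower bounds to invertibility (`|det g_i| ≥ (2r)^{-n}` in print) is the determinant-free
`norm_coord_le_of_gramSchmidt_bounds`.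

## References

* [BookerThorne2014] A. R. Booker, F. Thorne, Algebra Number Theory 8 (2014), 2027–2042, §3,
  Prop. 10 and its proof; §2.1, Lemma 3 (arXiv:1306.6362, read).
-/

noncomputable section

open Finset Matrix
open scoped InnerProductSpace ComplexConjugate

namespace Literature.Barriers.RiemannHypothesis

namespace BookerThorne2014

/-! ### The atoms of the fair partition: mass and Gram entries of one prime -/

/-- The atom attached to a prime `p`: its mass `ω_p` and the real and imaginary parts of the
`n²` Gram entries `ω_p Λ_p(i) conj(Λ_p(j))`, as a vector of a Euclidean space. Its squared norm is
`ω_p² (1 + ‖Λ_p‖⁴)`. [folklore] -/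
theorem norm_sq_atom {n : ℕ} (ω : ℝ) (Λ : EuclideanSpace ℂ (Fin n)) :
    ‖(WithLp.toLp 2 (fun o : Option (Fin n × Fin n × Bool) ↦ Option.elim o ω
      (fun x ↦ ω * (if x.2.2 then (Λ x.1 * conj (Λ x.2.1)).im else (Λ x.1 * conj (Λ x.2.1)).re)))
      : EuclideanSpace ℝ (Option (Fin n × Fin n × Bool)))‖ ^ 2 = ω ^ 2 * (1 + ‖Λ‖ ^ 4) := by
  rw [EuclideanSpace.norm_eq, Real.sq_sqrt (Finset.sum_nonneg fun _ _ ↦ by positivity)]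
  rw [Fintype.sum_option]
  simp only [Option.elim_none, Option.elim_some, Real.norm_eq_abs, sq_abs]
  have hnorm : ‖Λ‖ ^ 4 = (∑ i, ‖Λ i‖ ^ 2) ^ 2 := by
    rw [EuclideanSpace.norm_eq, show (4 : ℕ) = 2 * 2 from rfl, pow_mul,
      Real.sq_sqrt (Finset.sum_nonneg fun _ _ ↦ by positivity)]
  have hentry : ∀ x : Fin n × Fin n × Bool,
      (ω * (if x.2.2 = true then (Λ x.1 * conj (Λ x.2.1)).im else (Λ x.1 * conj (Λ x.2.1)).re)) ^ 2 =
        ω ^ 2 * (if x.2.2 = true then (Λ x.1 * conj (Λ x.2.1)).im ^ 2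
          else (Λ x.1 * conj (Λ x.2.1)).re ^ 2) := by
    intro x
    split_ifs <;> ring
  simp_rw [hentry]
  rw [← Finset.mul_sum, Fintype.sum_prod_type]
  simp_rw [Fintype.sum_prod_type, Fintype.sum_bool]
  simp only [if_true, Bool.false_eq_true, if_false]
  have hij : ∀ i j : Fin n, (Λ i * conj (Λ j)).im ^ 2 + (Λ i * conj (Λ j)).re ^ 2 =
      ‖Λ i‖ ^ 2 * ‖Λ j‖ ^ 2 := by
    intro i j
    rw [← mul_pow, ← Complex.norm_conj (Λ j), ← norm_mul, Complex.sq_norm, Complex.normSq_apply]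
    ring
  simp_rw [hij, ← Finset.mul_sum]
  rw [hnorm, sq (∑ i, ‖Λ i‖ ^ 2), Finset.sum_mul]
  ring

/-! ### Fair classes for the Gram data -/

/-- **Fair classes for masses and Gram entries simultaneously** (the replacement of the residue
classes `S_{ik}(y)` of [BookerThorne2014], Prop. 10, see `exists_fair_partition`): the primes of
a finite window `Pw` can be sorted into `M` classes each of which carries a share
`θ_c ∈ [1/(2M), 2/M]` of the total mass `∑ ω_p` and of every Gram entry
`∑ ω_p Λ_p(i) conj(Λ_p(j))`, up to errors `2W₀`, `4W₀`, where `W₀² ≥ ∑ ω_p² (1 + ‖Λ_p‖⁴)`.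
[cite: BookerThorne2014, Prop. 10 (partition of `S(y)` into the `S_{ik}(y)`)] -/
theorem exists_fair_gram_classes {n : ℕ} (Pw : Finset ℕ) (ω : ℕ → ℝ)
    (Λ : ℕ → EuclideanSpace ℂ (Fin n)) {M : ℕ} (hM : 0 < M) {W₀ : ℝ}
    (hW : Real.sqrt (∑ p ∈ Pw, ω p ^ 2 * (1 + ‖Λ p‖ ^ 4)) ≤ W₀) :
    ∃ cls : ℕ → ℕ, (∀ p, cls p < M) ∧ ∀ c : ℕ, c < M → ∃ θ : ℝ, 1 / (2 * M) ≤ θ ∧ θ ≤ 2 / M ∧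
      |∑ p ∈ Pw.filter (fun p ↦ cls p = c), ω p - θ * ∑ p ∈ Pw, ω p| ≤ 2 * W₀ ∧
      ∀ i j : Fin n,
        ‖∑ p ∈ Pw.filter (fun p ↦ cls p = c), (ω p : ℂ) * (Λ p i * conj (Λ p j)) -
          (θ : ℂ) * ∑ p ∈ Pw, (ω p : ℂ) * (Λ p i * conj (Λ p j))‖ ≤ 4 * W₀ := by
  classical
  -- the atoms
  set atom : ℕ → EuclideanSpace ℝ (Option (Fin n × Fin n × Bool)) := fun p ↦
    WithLp.toLp 2 (fun o : Option (Fin n × Fin n × Bool) ↦ Option.elim o (ω p)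
      (fun x ↦ ω p * (if x.2.2 then (Λ p x.1 * conj (Λ p x.2.1)).im
        else (Λ p x.1 * conj (Λ p x.2.1)).re))) with hatom
  have hW' : Real.sqrt (∑ p ∈ Pw, ‖atom p‖ ^ 2) ≤ W₀ := by
    have : ∀ p, ‖atom p‖ ^ 2 = ω p ^ 2 * (1 + ‖Λ p‖ ^ 4) := fun p ↦ norm_sq_atom (ω p) (Λ p)
    simp_rw [this]
    exact hW
  obtain ⟨cls, hcls, hfair⟩ :=
    Literature.Combinatorics.VectorBalancing.exists_fair_partition Pw atom hM
  refine ⟨cls, hcls, fun c hc ↦ ?_⟩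
  obtain ⟨θ, hθ1, hθ2, herr⟩ := hfair c hc
  set D := ∑ p ∈ Pw.filter (fun p ↦ cls p = c), atom p - θ • ∑ p ∈ Pw, atom p with hD
  have hDle : ‖D‖ ≤ 2 * W₀ := herr.trans (by linarith)
  have hcoord : ∀ o, |D o| ≤ 2 * W₀ := fun o ↦
    le_trans (by simpa [Real.norm_eq_abs] using PiLp.norm_apply_le D o) hDle
  -- coordinates of `D`
  have hDnone : D none = ∑ p ∈ Pw.filter (fun p ↦ cls p = c), ω p - θ * ∑ p ∈ Pw, ω p := by
    simp [hD, hatom]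
  have hDre : ∀ i j : Fin n, D (some (i, j, false)) =
      (∑ p ∈ Pw.filter (fun p ↦ cls p = c), (ω p : ℂ) * (Λ p i * conj (Λ p j)) -
        (θ : ℂ) * ∑ p ∈ Pw, (ω p : ℂ) * (Λ p i * conj (Λ p j))).re := by
    intro i j
    simp [hD, hatom, Complex.re_sum]
  have hDim : ∀ i j : Fin n, D (some (i, j, true)) =
      (∑ p ∈ Pw.filter (fun p ↦ cls p = c), (ω p : ℂ) * (Λ p i * conj (Λ p j)) -
        (θ : ℂ) * ∑ p ∈ Pw, (ω p : ℂ) * (Λ p i * conj (Λ p j))).im := by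
    intro i j
    simp [hD, hatom, Complex.im_sum]
  refine ⟨θ, hθ1, hθ2, ?_, fun i j ↦ ?_⟩
  · rw [← hDnone]; exact hcoord none
  · refine (Complex.norm_le_abs_re_add_abs_im _).trans ?_
    rw [← hDre, ← hDim]
    linarith [hcoord (some (i, j, false)), hcoord (some (i, j, true))]

/-! ### The Gram quadratic form -/

/-- `‖⟪u, Λ⟫‖² = ∑_{i,j} conj(u_i) u_j Λ_i conj(Λ_j)` on `ℂⁿ`. [folklore] -/
theorem norm_inner_sq_eq_sum {n : ℕ} (u Λ : EuclideanSpace ℂ (Fin n)) :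
    ((‖⟪u, Λ⟫_ℂ‖ : ℂ)) ^ 2 = ∑ i, ∑ j, conj (u i) * u j * (Λ i * conj (Λ j)) := by
  have hinner : ⟪u, Λ⟫_ℂ = ∑ i, conj (u i) * Λ i := by
    simp [PiLp.inner_apply, mul_comm]
  rw [← Complex.mul_conj', hinner, map_sum, Finset.sum_mul_sum]
  refine Finset.sum_congr rfl fun i _ ↦ Finset.sum_congr rfl fun j _ ↦ ?_
  simp only [map_mul, Complex.conj_conj]
  ring

/-- The Gram quadratic form of a set of primes in terms of the Gram entries:
`∑_{p∈S} ω_p ‖⟪u, Λ_p⟫‖² = ∑_{i,j} conj(u_i) u_j E_{ij}(S)`, `E_{ij}(S) = ∑_{p∈S} ω_p Λ_p(i) conj(Λ_p(j))`.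
[folklore] -/
theorem gram_eq_sum_entries {n : ℕ} (S : Finset ℕ) (ω : ℕ → ℝ) (Λ : ℕ → EuclideanSpace ℂ (Fin n))
    (u : EuclideanSpace ℂ (Fin n)) :
    ((∑ p ∈ S, ω p * ‖⟪u, Λ p⟫_ℂ‖ ^ 2 : ℝ) : ℂ) =
      ∑ i, ∑ j, conj (u i) * u j * ∑ p ∈ S, (ω p : ℂ) * (Λ p i * conj (Λ p j)) := by
  push_cast
  simp_rw [norm_inner_sq_eq_sum, Finset.mul_sum]
  rw [Finset.sum_comm]
  refine Finset.sum_congr rfl fun i _ ↦ ?_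
  rw [Finset.sum_comm]
  refine Finset.sum_congr rfl fun j _ ↦ ?_
  refine Finset.sum_congr rfl fun p _ ↦ ?_
  ring

/-- `(∑_i |u_i|)² ≤ n ‖u‖²` on `ℂⁿ` (Cauchy–Schwarz). [folklore] -/
theorem sum_norm_sq_le {n : ℕ} (u : EuclideanSpace ℂ (Fin n)) :
    (∑ i, ‖u i‖) ^ 2 ≤ n * ‖u‖ ^ 2 := by
  have h := Finset.sum_mul_sq_le_sq_mul_sq (Finset.univ : Finset (Fin n)) (fun i ↦ ‖u i‖)
    (fun _ ↦ (1 : ℝ))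
  simp only [mul_one, one_pow, Finset.sum_const, Finset.card_univ, Fintype.card_fin,
    nsmul_eq_mul, mul_one] at h
  rw [EuclideanSpace.norm_eq, Real.sq_sqrt (Finset.sum_nonneg fun _ _ ↦ by positivity)]
  linarith

/-- **Error in the quadratic form from errors in the entries**: if `‖E_{ij}‖ ≤ δ` for all
`i, j` then `‖∑_{ij} conj(u_i) u_j E_{ij}‖ ≤ δ n ‖u‖²`. [folklore] -/
theorem norm_sum_conj_mul_mul_le {n : ℕ} {E : Fin n → Fin n → ℂ} {δ : ℝ} (hδ : 0 ≤ δ)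
    (hE : ∀ i j, ‖E i j‖ ≤ δ) (u : EuclideanSpace ℂ (Fin n)) :
    ‖∑ i, ∑ j, conj (u i) * u j * E i j‖ ≤ δ * n * ‖u‖ ^ 2 := by
  calc ‖∑ i, ∑ j, conj (u i) * u j * E i j‖ ≤ ∑ i, ∑ j, ‖conj (u i) * u j * E i j‖ := by
        refine (norm_sum_le _ _).trans (Finset.sum_le_sum fun i _ ↦ norm_sum_le _ _)
    _ ≤ ∑ i, ∑ j, ‖u i‖ * ‖u j‖ * δ := by
        refine Finset.sum_le_sum fun i _ ↦ Finset.sum_le_sum fun j _ ↦ ?_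
        rw [norm_mul, norm_mul, Complex.norm_conj]
        exact mul_le_mul_of_nonneg_left (hE i j) (by positivity)
    _ = δ * (∑ i, ‖u i‖) ^ 2 := by
        rw [sq, Finset.sum_mul_sum, Finset.mul_sum]
        refine Finset.sum_congr rfl fun i _ ↦ ?_
        rw [Finset.mul_sum]
        refine Finset.sum_congr rfl fun j _ ↦ ?_
        ring
    _ ≤ δ * (n * ‖u‖ ^ 2) := mul_le_mul_of_nonneg_left (sum_norm_sq_le u) hδ
    _ = δ * n * ‖u‖ ^ 2 := by ring

/-- **The Gram form of a fair class** is at least `θ` times that of the window minus the error: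
if the entries satisfy `‖E_{ij}(S) − θ E_{ij}(Pw)‖ ≤ δ` then
`∑_{p∈S} ω_p ‖⟪u,Λ_p⟫‖² ≥ θ ∑_{p∈Pw} ω_p ‖⟪u,Λ_p⟫‖² − δ n ‖u‖²`.
[cite: BookerThorne2014, Prop. 10 (via Lemma 3 in progressions; here via fair classes)] -/
theorem gram_class_ge {n : ℕ} (S Pw : Finset ℕ) (ω : ℕ → ℝ) (Λ : ℕ → EuclideanSpace ℂ (Fin n))
    {θ δ : ℝ} (hδ : 0 ≤ δ)
    (hE : ∀ i j : Fin n, ‖∑ p ∈ S, (ω p : ℂ) * (Λ p i * conj (Λ p j)) -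
      (θ : ℂ) * ∑ p ∈ Pw, (ω p : ℂ) * (Λ p i * conj (Λ p j))‖ ≤ δ) (u : EuclideanSpace ℂ (Fin n)) :
    θ * ∑ p ∈ Pw, ω p * ‖⟪u, Λ p⟫_ℂ‖ ^ 2 - δ * n * ‖u‖ ^ 2 ≤ ∑ p ∈ S, ω p * ‖⟪u, Λ p⟫_ℂ‖ ^ 2 := by
  have h := norm_sum_conj_mul_mul_le hδ hE u
  have hid : ∑ i, ∑ j, conj (u i) * u j * (∑ p ∈ S, (ω p : ℂ) * (Λ p i * conj (Λ p j)) -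
      (θ : ℂ) * ∑ p ∈ Pw, (ω p : ℂ) * (Λ p i * conj (Λ p j))) =
      (((∑ p ∈ S, ω p * ‖⟪u, Λ p⟫_ℂ‖ ^ 2 : ℝ) : ℂ) -
        (θ : ℂ) * ((∑ p ∈ Pw, ω p * ‖⟪u, Λ p⟫_ℂ‖ ^ 2 : ℝ) : ℂ)) := by
    rw [gram_eq_sum_entries S ω Λ u, gram_eq_sum_entries Pw ω Λ u, Finset.mul_sum,
      ← Finset.sum_sub_distrib]
    refine Finset.sum_congr rfl fun i _ ↦ ?_
    rw [Finset.mul_sum, ← Finset.sum_sub_distrib]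
    refine Finset.sum_congr rfl fun j _ ↦ ?_
    ring
  rw [hid, ← Complex.ofReal_mul, ← Complex.ofReal_sub, Complex.norm_real, Real.norm_eq_abs] at h
  have := (abs_le.1 h).1
  linarith

/-! ### Adaptive columns (Gram–Schmidt directions and aligned phases) -/

/-- In `ℂⁿ` there is a unit vector orthogonal to any `m < n` given vectors. [folklore] -/
theorem exists_unit_orthogonal {n m : ℕ} (hm : m < n) (v : ℕ → EuclideanSpace ℂ (Fin n)) :
    ∃ u : EuclideanSpace ℂ (Fin n), ‖u‖ = 1 ∧ ∀ j, j < m → ⟪u, v j⟫_ℂ = 0 := by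
  classical
  set K : Submodule ℂ (EuclideanSpace ℂ (Fin n)) :=
    Submodule.span ℂ (((Finset.range m).image v : Finset _) : Set (EuclideanSpace ℂ (Fin n)))
    with hK
  have hKle : Module.finrank ℂ K ≤ m :=
    (finrank_span_finset_le_card _).trans ((Finset.card_image_le).trans (by simp))
  have hsum := Submodule.finrank_add_finrank_orthogonal K
  rw [finrank_euclideanSpace_fin] at hsum
  have hKo : Kᗮ ≠ ⊥ := by
    intro h
    rw [h, finrank_bot] at hsum
    omega
  obtain ⟨w, hwK, hw0⟩ := Submodule.exists_mem_ne_zero_of_ne_bot hKo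
  have hwn : ‖w‖ ≠ 0 := norm_ne_zero_iff.2 hw0
  refine ⟨((‖w‖⁻¹ : ℝ) : ℂ) • w, ?_, fun j hj ↦ ?_⟩
  · rw [norm_smul, Complex.norm_real, norm_inv, norm_norm, inv_mul_cancel₀ hwn]
  · rw [inner_smul_left]
    have : ⟪w, v j⟫_ℂ = 0 := by
      rw [Submodule.mem_orthogonal'] at hwK
      refine hwK (v j) (Submodule.subset_span ?_)
      simp only [Finset.coe_image, Finset.coe_range, Set.mem_image, Set.mem_Iio]
      exact ⟨j, hj, rfl⟩
    rw [this, mul_zero]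

/-- The phase aligning a complex number with the positive reals: `ε z = ‖z‖`, `‖ε‖ = 1`.
[folklore] -/
theorem exists_aligning_phase (z : ℂ) : ∃ ε : ℂ, ‖ε‖ = 1 ∧ ε * z = ‖z‖ := by
  rcases eq_or_ne z 0 with rfl | hz
  · exact ⟨1, norm_one, by simp⟩
  have hzn : (‖z‖ : ℂ) ≠ 0 := by exact_mod_cast norm_ne_zero_iff.2 hz
  refine ⟨conj z / ‖z‖, ?_, ?_⟩
  · rw [norm_div, Complex.norm_conj, Complex.norm_real, norm_norm, div_self (norm_ne_zero_iff.2 hz)]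
  · rw [div_mul_eq_mul_div, mul_comm, Complex.mul_conj', sq, mul_div_assoc, div_self hzn, mul_one]

/-- **Adaptive columns** ([BookerThorne2014], proof of Prop. 10: "We will show by induction that
there is a choice of the `ε_p` such that `|v_ℓ − proj_{span{v_1,…,v_{ℓ−1}}} v_ℓ| ≥ 1/(2r)` …
Choose a unit vector `u` orthogonal to `v_1, …, v_{k−1}` … for each `p ∈ S_{ik}` we choose `ε_p`
such that `ε_p (ū_1λ_1(p) + … + ū_nλ_n(p))` is real and nonnegative"). Given pairwise disjoint
classes `S_k` with Gram forms `≥ γ₁` on unit vectors and masses `≤ μ₁`, vectors `‖Λ_p‖ ≤ r`, and a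
scale `c ≥ 0`, there are unimodular phases `ε_p` and, for `k < m ≤ n`, columns
`v_k = c ∑_{p∈S_k} ε_p ω_p Λ_p` and unit vectors `u_k ⊥ v_j` (`j < k`) with
`‖⟨u_k, v_k⟩‖ ≥ c γ₁ / r` and `‖v_k‖ ≤ c r μ₁`. [cite: BookerThorne2014, proof of Prop. 10] -/
theorem exists_adaptive_columns {n : ℕ} (S : ℕ → Finset ℕ)
    (hdisj : ∀ j k, j ≠ k → Disjoint (S j) (S k)) (ω : ℕ → ℝ) (hω : ∀ p, 0 ≤ ω p)
    (Λ : ℕ → EuclideanSpace ℂ (Fin n)) {r : ℝ} (hr : 0 < r) (hΛ : ∀ p, ‖Λ p‖ ≤ r) {γ₁ μ₁ : ℝ}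
    (hγ : ∀ k, k < n → ∀ u : EuclideanSpace ℂ (Fin n), ‖u‖ = 1 →
      γ₁ ≤ ∑ p ∈ S k, ω p * ‖⟪u, Λ p⟫_ℂ‖ ^ 2)
    (hμ : ∀ k, k < n → ∑ p ∈ S k, ω p ≤ μ₁) {c : ℝ} (hc : 0 ≤ c) :
    ∀ m, m ≤ n → ∃ (ε : ℕ → ℂ) (u v : ℕ → EuclideanSpace ℂ (Fin n)), (∀ p, ‖ε p‖ = 1) ∧
      ∀ k, k < m → v k = (c : ℂ) • ∑ p ∈ S k, (ε p * ω p) • Λ p ∧ ‖u k‖ = 1 ∧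
        (∀ j, j < k → ⟪u k, v j⟫_ℂ = 0) ∧ c * γ₁ / r ≤ ‖⟪u k, v k⟫_ℂ‖ ∧ ‖v k‖ ≤ c * r * μ₁ := by
  classical
  intro m
  induction m with
  | zero => intro _; exact ⟨fun _ ↦ 1, 0, 0, fun _ ↦ norm_one, fun k hk ↦ absurd hk (Nat.not_lt_zero k)⟩
  | succ m ih =>
    intro hm
    obtain ⟨ε, u, v, hε, hP⟩ := ih (Nat.le_of_succ_le hm)
    have hmn : m < n := hm
    -- the new direction and phases
    obtain ⟨u', hu'1, hu'orth⟩ := exists_unit_orthogonal hmn v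
    have hphase : ∀ p, ∃ e : ℂ, ‖e‖ = 1 ∧ e * ⟪u', Λ p⟫_ℂ = ‖⟪u', Λ p⟫_ℂ‖ := fun p ↦
      exists_aligning_phase _
    choose φ hφ1 hφal using hphase
    set ε' : ℕ → ℂ := fun p ↦ if p ∈ S m then φ p else ε p with hε'
    set vm : EuclideanSpace ℂ (Fin n) := (c : ℂ) • ∑ p ∈ S m, (ε' p * ω p) • Λ p with hvm
    refine ⟨ε', fun k ↦ if k = m then u' else u k, fun k ↦ if k = m then vm else v k,
      fun p ↦ ?_, fun k hk ↦ ?_⟩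
    · simp only [hε']
      split_ifs
      · exact hφ1 p
      · exact hε p
    -- phases agree with the old ones off `S m`
    have hagree : ∀ k, k ≠ m → ∀ p ∈ S k, ε' p = ε p := by
      intro k hkm p hp
      have : p ∉ S m := Finset.disjoint_left.1 (hdisj k m hkm) hp
      simp [hε', this]
    rcases Nat.lt_succ_iff_lt_or_eq.1 hk with hk' | hkm
    · -- an old column
      obtain ⟨hv, hu1, horth, hlow, hup⟩ := hP k hk'
      have hkm : k ≠ m := hk'.ne
      simp only [if_neg hkm]
      refine ⟨?_, hu1, fun j hj ↦ ?_, hlow, hup⟩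
      · rw [hv]
        congr 1
        exact Finset.sum_congr rfl fun p hp ↦ by rw [hagree k hkm p hp]
      · rw [if_neg (hj.trans hk').ne]
        exact horth j hj
    · -- the new column `k = m`
      rw [hkm]
      simp only [if_true]
      refine ⟨rfl, hu'1, fun j hj ↦ ?_, ?_, ?_⟩
      · rw [if_neg hj.ne]
        exact hu'orth j hj
      · -- `⟨u', vm⟩ = c ∑ ω_p ‖⟨u', Λ_p⟩‖ ≥ c γ₁ / r`
        have hinner : ⟪u', vm⟫_ℂ = ((c * ∑ p ∈ S m, ω p * ‖⟪u', Λ p⟫_ℂ‖ : ℝ) : ℂ) := by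
          rw [hvm, inner_smul_right, inner_sum]
          push_cast
          congr 1
          refine Finset.sum_congr rfl fun p hp ↦ ?_
          rw [inner_smul_right]
          have : ε' p = φ p := by simp [hε', hp]
          rw [this, ← hφal p]
          ring
        rw [hinner, Complex.norm_real, Real.norm_of_nonneg (mul_nonneg hc
          (Finset.sum_nonneg fun p _ ↦ mul_nonneg (hω p) (norm_nonneg _)))]
        have hzp : ∀ p, ‖⟪u', Λ p⟫_ℂ‖ ^ 2 ≤ r * ‖⟪u', Λ p⟫_ℂ‖ := by
          intro p
          have h1 : ‖⟪u', Λ p⟫_ℂ‖ ≤ r := by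
            calc ‖⟪u', Λ p⟫_ℂ‖ ≤ ‖u'‖ * ‖Λ p‖ := norm_inner_le_norm _ _
              _ ≤ 1 * r := by rw [hu'1]; exact mul_le_mul_of_nonneg_left (hΛ p) zero_le_one
              _ = r := one_mul r
          rw [sq]
          exact mul_le_mul_of_nonneg_right h1 (norm_nonneg _)
        have hsum : γ₁ ≤ r * ∑ p ∈ S m, ω p * ‖⟪u', Λ p⟫_ℂ‖ := by
          calc γ₁ ≤ ∑ p ∈ S m, ω p * ‖⟪u', Λ p⟫_ℂ‖ ^ 2 := hγ m hmn u' hu'1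
            _ ≤ ∑ p ∈ S m, ω p * (r * ‖⟪u', Λ p⟫_ℂ‖) :=
                Finset.sum_le_sum fun p _ ↦ mul_le_mul_of_nonneg_left (hzp p) (hω p)
            _ = r * ∑ p ∈ S m, ω p * ‖⟪u', Λ p⟫_ℂ‖ := by
                rw [Finset.mul_sum]; exact Finset.sum_congr rfl fun _ _ ↦ by ring
        rw [div_le_iff₀ hr]
        nlinarith
      · -- `‖vm‖ ≤ c r μ₁`
        rw [hvm, norm_smul, Complex.norm_real, Real.norm_of_nonneg hc, mul_assoc]
        refine mul_le_mul_of_nonneg_left ?_ hc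
        calc ‖∑ p ∈ S m, (ε' p * ω p) • Λ p‖ ≤ ∑ p ∈ S m, ‖(ε' p * ω p) • Λ p‖ := norm_sum_le _ _
          _ ≤ ∑ p ∈ S m, ω p * r := Finset.sum_le_sum fun p hp ↦ by
              have : ε' p = φ p := by simp [hε', hp]
              rw [norm_smul, norm_mul, this, hφ1, one_mul, Complex.norm_real,
                Real.norm_of_nonneg (hω p)]
              exact mul_le_mul_of_nonneg_left (hΛ p) (hω p)
          _ = r * ∑ p ∈ S m, ω p := by rw [Finset.mul_sum]; exact Finset.sum_congr rfl fun _ _ ↦ mul_comm _ _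
          _ ≤ r * μ₁ := mul_le_mul_of_nonneg_left (hμ m hmn) hr.le

/-! ### Quantitative invertibility -/

section ColumnBound

variable {V : Type*} [NormedAddCommGroup V] [InnerProductSpace ℂ V]

/-- **Quantitative invertibility from Gram–Schmidt lower bounds** ([BookerThorne2014], proof of
Prop. 10: "Applying Gram–Schmidt orthogonalization to `v_1, …, v_n`, it follows from
`|v_ℓ − proj_{span{v_1,…,v_{ℓ−1}}} v_ℓ| ≥ 1/(2r)` that `|det g_i| ≥ (2r)^{-n}`", here in the form
that is used — a lower bound for `‖∑ x_j v_j‖` — and without determinants): if `‖u_k‖ ≤ 1`,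
`u_k ⊥ v_j` for `j < k`, `|⟨u_k, v_k⟩| ≥ c₀ > 0` and `‖v_k‖ ≤ A'` for all `k < m`, then
`|x_k| ≤ c₀⁻¹ (1 + A'/c₀)^{m−1} ‖∑_j x_j v_j‖` for every `x ∈ ℂ^m` and every `k`
(peel off the last vector: `⟨u_{m−1}, ∑ x_j v_j⟩ = x_{m−1} ⟨u_{m−1}, v_{m−1}⟩`).
[cite: BookerThorne2014, proof of Prop. 10] -/
theorem norm_coord_le_of_gramSchmidt_bounds {c₀ A' : ℝ} (hc₀ : 0 < c₀) (hA' : 0 ≤ A') :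
    ∀ (m : ℕ) (v u : Fin m → V), (∀ k, ‖u k‖ ≤ 1) →
      (∀ j k : Fin m, j < k → ⟪u k, v j⟫_ℂ = 0) → (∀ k, c₀ ≤ ‖⟪u k, v k⟫_ℂ‖) →
      (∀ k, ‖v k‖ ≤ A') →
      ∀ (x : Fin m → ℂ) (k : Fin m),
        ‖x k‖ ≤ c₀⁻¹ * (1 + A' / c₀) ^ (m - 1) * ‖∑ j, x j • v j‖ := by
  intro m
  induction m with
  | zero => intro v u _ _ _ _ x k; exact k.elim0
  | succ m ih =>
    intro v u hu horth hdiag hcol x k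
    set y : V := ∑ j, x j • v j with hy
    have hq : 1 ≤ 1 + A' / c₀ := by
      have : 0 ≤ A' / c₀ := div_nonneg hA' hc₀.le
      linarith
    -- the last coordinate
    have hlast : ‖x (Fin.last m)‖ ≤ c₀⁻¹ * ‖y‖ := by
      have hinner : ⟪u (Fin.last m), y⟫_ℂ = x (Fin.last m) * ⟪u (Fin.last m), v (Fin.last m)⟫_ℂ := by
        rw [hy, inner_sum, Fin.sum_univ_castSucc]
        have h0 : ∑ j : Fin m, ⟪u (Fin.last m), x (Fin.castSucc j) • v (Fin.castSucc j)⟫_ℂ = 0 := by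
          refine Finset.sum_eq_zero fun j _ ↦ ?_
          rw [inner_smul_right, horth _ _ (Fin.castSucc_lt_last j), mul_zero]
        rw [h0, zero_add, inner_smul_right]
      have h1 : ‖x (Fin.last m)‖ * c₀ ≤ ‖y‖ := by
        calc ‖x (Fin.last m)‖ * c₀ ≤ ‖x (Fin.last m)‖ * ‖⟪u (Fin.last m), v (Fin.last m)⟫_ℂ‖ :=
              mul_le_mul_of_nonneg_left (hdiag _) (norm_nonneg _)
          _ = ‖⟪u (Fin.last m), y⟫_ℂ‖ := by rw [hinner, norm_mul]
          _ ≤ ‖u (Fin.last m)‖ * ‖y‖ := norm_inner_le_norm _ _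
          _ ≤ 1 * ‖y‖ := mul_le_mul_of_nonneg_right (hu _) (norm_nonneg _)
          _ = ‖y‖ := one_mul _
      rw [inv_mul_eq_div, le_div_iff₀ hc₀]
      exact h1
    refine Fin.lastCases ?_ (fun k' ↦ ?_) k
    · -- `k = last`
      calc ‖x (Fin.last m)‖ ≤ c₀⁻¹ * ‖y‖ := hlast
        _ ≤ c₀⁻¹ * (1 + A' / c₀) ^ (m + 1 - 1) * ‖y‖ := by
            rw [mul_assoc]
            refine mul_le_mul_of_nonneg_left ?_ (inv_nonneg.2 hc₀.le)
            exact le_mul_of_one_le_left (norm_nonneg _) (one_le_pow₀ hq)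
    · -- `k = castSucc k'`: induction on the first `m` vectors
      set y' : V := ∑ j : Fin m, x (Fin.castSucc j) • v (Fin.castSucc j) with hy'
      have hyy' : y = y' + x (Fin.last m) • v (Fin.last m) := by
        rw [hy, Fin.sum_univ_castSucc]
      have hy'norm : ‖y'‖ ≤ (1 + A' / c₀) * ‖y‖ := by
        have h1 : y' = y - x (Fin.last m) • v (Fin.last m) := by rw [hyy']; abel
        calc ‖y'‖ ≤ ‖y‖ + ‖x (Fin.last m) • v (Fin.last m)‖ := by rw [h1]; exact norm_sub_le _ _
          _ = ‖y‖ + ‖x (Fin.last m)‖ * ‖v (Fin.last m)‖ := by rw [norm_smul]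
          _ ≤ ‖y‖ + c₀⁻¹ * ‖y‖ * A' := by
              gcongr ‖y‖ + ?_
              exact mul_le_mul hlast (hcol _) (norm_nonneg _) (by positivity)
          _ = (1 + A' / c₀) * ‖y‖ := by rw [inv_mul_eq_div]; ring
      have hIH := ih (fun j ↦ v (Fin.castSucc j)) (fun j ↦ u (Fin.castSucc j))
        (fun j ↦ hu _) (fun j j' hjj' ↦ horth _ _ (by simpa using hjj')) (fun j ↦ hdiag _)
        (fun j ↦ hcol _) (fun j ↦ x (Fin.castSucc j)) k'
      rw [← hy'] at hIH
      -- `m ≥ 1` here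
      obtain ⟨m', rfl⟩ : ∃ m', m = m' + 1 := ⟨m - 1, (Nat.succ_pred_eq_of_pos (Fin.pos k')).symm⟩
      simp only [Nat.add_sub_cancel] at hIH ⊢
      calc ‖x (Fin.castSucc k')‖ ≤ c₀⁻¹ * (1 + A' / c₀) ^ m' * ‖y'‖ := hIH
        _ ≤ c₀⁻¹ * (1 + A' / c₀) ^ m' * ((1 + A' / c₀) * ‖y‖) :=
            mul_le_mul_of_nonneg_left hy'norm (by positivity)
        _ = c₀⁻¹ * (1 + A' / c₀) ^ (m' + 1) * ‖y‖ := by rw [pow_succ]; ring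


end ColumnBound

/-- The Euclidean norm on `ℂⁿ` is at most `√n` times the sup norm. [folklore] -/
theorem norm_toLp_le_sqrt_mul {n : ℕ} (y : Fin n → ℂ) :
    ‖(WithLp.toLp 2 y : EuclideanSpace ℂ (Fin n))‖ ≤ Real.sqrt n * ‖y‖ := by
  rw [EuclideanSpace.norm_eq]
  have h : ∑ i, ‖(WithLp.toLp 2 y : EuclideanSpace ℂ (Fin n)) i‖ ^ 2 ≤ n * ‖y‖ ^ 2 := by
    calc ∑ i, ‖(WithLp.toLp 2 y : EuclideanSpace ℂ (Fin n)) i‖ ^ 2 ≤ ∑ _i : Fin n, ‖y‖ ^ 2 :=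
          Finset.sum_le_sum fun i _ ↦ by
            rw [PiLp.toLp_apply]
            exact pow_le_pow_left₀ (norm_nonneg _) (norm_le_pi_norm y i) 2
      _ = n * ‖y‖ ^ 2 := by simp
  calc Real.sqrt (∑ i, ‖(WithLp.toLp 2 y : EuclideanSpace ℂ (Fin n)) i‖ ^ 2)
      ≤ Real.sqrt (n * ‖y‖ ^ 2) := Real.sqrt_le_sqrt h
    _ = Real.sqrt n * ‖y‖ := by rw [Real.sqrt_mul (Nat.cast_nonneg n), Real.sqrt_sq (norm_nonneg _)]

/-! ### Proposition 10, abstract form -/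

/-- **Booker–Thorne 2014, Proposition 10 (abstract form).** Data: a finite window `Pw` of
"primes" with masses `ω_p ≥ 0` (total `s₀ > 0`) and vectors `Λ_p ∈ ℂⁿ`, `‖Λ_p‖ ≤ r` (in the
application `ω_p = p^{-σ}`, `Λ_p = (λ_j(p))_j`, `r = 2√n` from the Ramanujan bound), whose Gram
form satisfies `∑ ω_p |⟨u, Λ_p⟩|² ≥ s₀/4` on unit vectors (Lemma 3) and whose atoms are small,
`64 M n W₀ ≤ s₀` with `W₀² ≥ ∑ ω_p²(1 + ‖Λ_p‖⁴)`, `M = |J| n`. Conclusion (the printed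
"there exists a partition of `S(y)` into `mn` pairwise disjoint subsets `S_{ik}(y)` and a choice
of `ε_p ∈ S¹` for each `p ∈ S(y)`, such that the `m`-tuple of matrices
`g_i = ((mn/s(y,σ)) ∑_{p∈S_{ik}(y)} ε_p λ_j(p) p^{-σ})_{j,k}` lies in `K^m`"): classes
`cls : ℕ → J × Fin n`, unimodular phases `ε_p`, and the matrices
`G_x = ((M/s₀) ∑_{p ∈ Pw, cls p = (x,k)} ε_p ω_p Λ_p(i))_{i,k}` lie in the compact set
`K(A, b) = {‖g z‖_∞ ≤ A‖z‖_∞, ‖g z‖_∞ ≥ b‖z‖_∞}` with `A = 3nr`,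
`b = (16 r (1 + 48r²)^{n−1} √n)⁻¹` depending only on `n, r`. The progressions of the printed
proof are replaced by the fair classes of `exists_fair_gram_classes`.
[cite: BookerThorne2014, Prop. 10] -/
theorem abstract_prop10 {n : ℕ} (hn : 0 < n) {J : Type*} [Fintype J] [DecidableEq J] [Nonempty J]
    (Pw : Finset ℕ) (ω : ℕ → ℝ) (hω : ∀ p, 0 ≤ ω p) (hs₀ : 0 < ∑ p ∈ Pw, ω p)
    (Λ : ℕ → EuclideanSpace ℂ (Fin n)) {r : ℝ} (hr : 0 < r) (hΛ : ∀ p, ‖Λ p‖ ≤ r)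
    {W₀ : ℝ} (hW₀ : 0 ≤ W₀) (hW : Real.sqrt (∑ p ∈ Pw, ω p ^ 2 * (1 + ‖Λ p‖ ^ 4)) ≤ W₀)
    (hgram : ∀ u : EuclideanSpace ℂ (Fin n), ‖u‖ = 1 →
      (∑ p ∈ Pw, ω p) / 4 ≤ ∑ p ∈ Pw, ω p * ‖⟪u, Λ p⟫_ℂ‖ ^ 2)
    (hbig : 64 * (Fintype.card J * n) * n * W₀ ≤ ∑ p ∈ Pw, ω p) :
    ∃ (cls : ℕ → J × Fin n) (ε : ℕ → ℂ) (G : J → Matrix (Fin n) (Fin n) ℂ),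
      (∀ p, ‖ε p‖ = 1) ∧
      (∀ x i k, G x i k = (((Fintype.card J * n : ℝ) / ∑ p ∈ Pw, ω p : ℝ) : ℂ) *
        ∑ p ∈ Pw.filter (fun p ↦ cls p = (x, k)), ε p * ω p * Λ p i) ∧
      (∀ x z, ‖G x *ᵥ z‖ ≤ (n * (3 * r)) * ‖z‖) ∧
      (∀ x z, (16 * r * (1 + 48 * r ^ 2) ^ (n - 1) * Real.sqrt n)⁻¹ * ‖z‖ ≤ ‖G x *ᵥ z‖) := by
  classical
  set M : ℕ := Fintype.card J * n with hMdef
  have hJ : 0 < Fintype.card J := Fintype.card_pos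
  have hM : 0 < M := Nat.mul_pos hJ hn
  set s₀ : ℝ := ∑ p ∈ Pw, ω p with hs₀def
  set c : ℝ := M / s₀ with hcdef
  have hc : 0 ≤ c := by positivity
  have hMreal : (0 : ℝ) < M := by exact_mod_cast hM
  have hnreal : (1 : ℝ) ≤ n := by exact_mod_cast hn
  -- fair classes
  obtain ⟨cls₀, hcls₀, hfair⟩ := exists_fair_gram_classes Pw ω Λ hM hW
  have hcard : Fintype.card (J × Fin n) = M := by simp [hMdef]
  set e : J × Fin n ≃ Fin M := (Fintype.equivFin (J × Fin n)).trans (finCongr hcard) with he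
  set cls : ℕ → J × Fin n := fun p ↦ e.symm ⟨cls₀ p, hcls₀ p⟩ with hclsdef
  -- the classes of one matrix
  set T : J → Fin n → Finset ℕ := fun x k ↦ Pw.filter (fun p ↦ cls p = (x, k)) with hT
  have hTeq : ∀ x k, T x k = Pw.filter (fun p ↦ cls₀ p = (e (x, k) : ℕ)) := by
    intro x k
    simp only [hT, hclsdef]
    congr 1
    ext p
    rw [Equiv.symm_apply_eq]
    constructor
    · intro h
      have := congrArg Fin.val h
      simpa using this
    · intro h
      exact Fin.ext h
  -- constants of the classes
  have hMcast : (M : ℝ) = Fintype.card J * n := by rw [hMdef]; push_cast; ring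
  have hbig' : 64 * M * n * W₀ ≤ s₀ := by
    have : (64 : ℝ) * (Fintype.card J * n) * n * W₀ = 64 * M * n * W₀ := by rw [hMcast]
    linarith [hbig]
  have hW4 : 4 * W₀ * n ≤ s₀ / (16 * M) := by
    rw [le_div_iff₀ (by positivity)]
    nlinarith
  have hW2 : 2 * W₀ ≤ s₀ / M := by
    rw [le_div_iff₀ hMreal]
    nlinarith [mul_nonneg hW₀ hMreal.le, mul_nonneg (mul_nonneg hW₀ hMreal.le) (by linarith : (0:ℝ) ≤ n - 1)]
  have hclass : ∀ x k, (∀ u : EuclideanSpace ℂ (Fin n), ‖u‖ = 1 →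
      s₀ / (16 * M) ≤ ∑ p ∈ T x k, ω p * ‖⟪u, Λ p⟫_ℂ‖ ^ 2) ∧ ∑ p ∈ T x k, ω p ≤ 3 * s₀ / M := by
    intro x k
    obtain ⟨θ, hθ1, hθ2, hmass, hent⟩ := hfair (e (x, k)) (e (x, k)).2
    rw [← hTeq] at hmass hent
    constructor
    · intro u hu
      have h := gram_class_ge (T x k) Pw ω Λ (θ := θ) (by positivity : (0 : ℝ) ≤ 4 * W₀) hent u
      rw [hu, one_pow, mul_one] at h
      have hg := hgram u hu
      have hθpos : 0 ≤ θ := le_trans (by positivity) hθ1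
      have : θ * (s₀ / 4) ≤ θ * ∑ p ∈ Pw, ω p * ‖⟪u, Λ p⟫_ℂ‖ ^ 2 :=
        mul_le_mul_of_nonneg_left hg hθpos
      have h2 : s₀ / (8 * M) ≤ θ * (s₀ / 4) := by
        rw [div_le_iff₀ (by positivity)]
        have := mul_le_mul_of_nonneg_right hθ1 (by positivity : (0 : ℝ) ≤ s₀ / 4 * (8 * M))
        have h3 : 1 / (2 * (M : ℝ)) * (s₀ / 4 * (8 * M)) = s₀ := by field_simp; ring
        nlinarith
      have h4 : s₀ / (16 * M) + s₀ / (16 * M) = s₀ / (8 * M) := by ring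
      linarith
    · have := (abs_le.1 hmass).2
      have h2 : θ * s₀ ≤ 2 / M * s₀ := mul_le_mul_of_nonneg_right hθ2 hs₀.le
      have h3 : 2 / (M : ℝ) * s₀ + s₀ / M = 3 * s₀ / M := by ring
      linarith
  -- adaptive columns, matrix by matrix
  have hcols : ∀ x : J, ∃ (εx : ℕ → ℂ) (u v : ℕ → EuclideanSpace ℂ (Fin n)), (∀ p, ‖εx p‖ = 1) ∧
      ∀ k : Fin n, v k = (c : ℂ) • ∑ p ∈ T x k, (εx p * ω p) • Λ p ∧ ‖u k‖ = 1 ∧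
        (∀ j : Fin n, j < k → ⟪u k, v j⟫_ℂ = 0) ∧ c * (s₀ / (16 * M)) / r ≤ ‖⟪u k, v k⟫_ℂ‖ ∧
        ‖v k‖ ≤ c * r * (3 * s₀ / M) := by
    intro x
    set S : ℕ → Finset ℕ := fun k ↦ if h : k < n then T x ⟨k, h⟩ else ∅ with hS
    have hdisj : ∀ j k, j ≠ k → Disjoint (S j) (S k) := by
      intro j k hjk
      simp only [hS]
      split_ifs with hj hk
      · rw [hT, Finset.disjoint_filter]
        intro p _ h1 h2
        rw [h1] at h2
        have := (Prod.mk.inj h2).2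
        exact hjk (by simpa using congrArg Fin.val this)
      · exact Finset.disjoint_empty_right _
      · exact Finset.disjoint_empty_left _
      · exact Finset.disjoint_empty_left _
    have hγ : ∀ k, k < n → ∀ u : EuclideanSpace ℂ (Fin n), ‖u‖ = 1 →
        s₀ / (16 * M) ≤ ∑ p ∈ S k, ω p * ‖⟪u, Λ p⟫_ℂ‖ ^ 2 := by
      intro k hk u hu
      simp only [hS, dif_pos hk]
      exact (hclass x ⟨k, hk⟩).1 u hu
    have hμ : ∀ k, k < n → ∑ p ∈ S k, ω p ≤ 3 * s₀ / M := by
      intro k hk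
      simp only [hS, dif_pos hk]
      exact (hclass x ⟨k, hk⟩).2
    obtain ⟨εx, u, v, hεx, hP⟩ :=
      exists_adaptive_columns S hdisj ω hω Λ hr hΛ hγ hμ hc n le_rfl
    refine ⟨εx, u, v, hεx, fun k ↦ ?_⟩
    obtain ⟨hv, hu1, horth, hlow, hup⟩ := hP k k.2
    simp only [hS, dif_pos k.2] at hv
    exact ⟨hv, hu1, fun j hj ↦ horth j hj, hlow, hup⟩
  choose εf uf vf hεf hvf using hcols
  -- global phases and the matrices
  set ε : ℕ → ℂ := fun p ↦ εf (cls p).1 p with hεdef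
  have hεT : ∀ x k, ∀ p ∈ T x k, εf x p = ε p := by
    intro x k p hp
    simp only [hT, Finset.mem_filter] at hp
    simp [hεdef, hp.2]
  set G : J → Matrix (Fin n) (Fin n) ℂ := fun x ↦ Matrix.of fun i k ↦ (vf x k) i with hGdef
  have hGv : ∀ x (z : Fin n → ℂ),
      (WithLp.toLp 2 (G x *ᵥ z) : EuclideanSpace ℂ (Fin n)) = ∑ k, z k • vf x k := by
    intro x z
    ext i
    simp [hGdef, Matrix.mulVec, dotProduct, mul_comm]
  have hcμ : c * r * (3 * s₀ / M) = 3 * r := by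
    rw [hcdef]; field_simp
  have hcγ : c * (s₀ / (16 * M)) / r = (16 * r)⁻¹ := by
    rw [hcdef]; field_simp
  refine ⟨cls, ε, G, fun p ↦ hεf _ p, fun x i k ↦ ?_, fun x z ↦ ?_, fun x z ↦ ?_⟩
  · -- the formula for the entries
    obtain ⟨hv, -, -, -, -⟩ := hvf x k
    have hcC : (((Fintype.card J * n : ℝ) / ∑ p ∈ Pw, ω p : ℝ) : ℂ) = (c : ℂ) := by
      rw [hcdef, hMcast]
    rw [hcC]
    simp only [hGdef, Matrix.of_apply]
    rw [hv]
    have : ∑ p ∈ T x k, (εf x p * ω p) • Λ p = ∑ p ∈ T x k, (ε p * ω p) • Λ p :=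
      Finset.sum_congr rfl fun p hp ↦ by rw [hεT x k p hp]
    rw [this]
    show ((c : ℂ) • ∑ p ∈ T x k, (ε p * ω p) • Λ p) i = (c : ℂ) * ∑ p ∈ T x k, ε p * ω p * Λ p i
    simp [Finset.mul_sum, mul_assoc]
  · -- upper bound
    refine (pi_norm_le_iff_of_nonneg (by positivity)).2 fun i ↦ ?_
    have hi : (G x *ᵥ z) i = (∑ k, z k • vf x k) i := by
      rw [← hGv]
    rw [hi]
    calc ‖(∑ k, z k • vf x k) i‖ ≤ ‖∑ k, z k • vf x k‖ := PiLp.norm_apply_le _ i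
      _ ≤ ∑ k, ‖z k • vf x k‖ := norm_sum_le _ _
      _ ≤ ∑ _k : Fin n, ‖z‖ * (3 * r) := Finset.sum_le_sum fun k _ ↦ by
          rw [norm_smul]
          obtain ⟨-, -, -, -, hup⟩ := hvf x k
          rw [hcμ] at hup
          exact mul_le_mul (norm_le_pi_norm z k) hup (norm_nonneg _) (norm_nonneg _)
      _ = n * (3 * r) * ‖z‖ := by simp [Finset.sum_const, Finset.card_univ, Fintype.card_fin]; ring
  · -- lower bound, from the Gram–Schmidt data
    have hcol := norm_coord_le_of_gramSchmidt_bounds (c₀ := (16 * r)⁻¹) (A' := 3 * r)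
      (by positivity) (by positivity) n (fun k ↦ vf x k) (fun k ↦ uf x k)
      (fun k ↦ (hvf x k).2.1.le)
      (fun j k hjk ↦ (hvf x k).2.2.1 j hjk)
      (fun k ↦ by have := (hvf x k).2.2.2.1; rwa [hcγ] at this)
      (fun k ↦ by have := (hvf x k).2.2.2.2; rwa [hcμ] at this) z
    set D : ℝ := (16 * r)⁻¹⁻¹ * (1 + 3 * r / (16 * r)⁻¹) ^ (n - 1) with hD
    have hDeq : D = 16 * r * (1 + 48 * r ^ 2) ^ (n - 1) := by
      rw [hD, inv_inv]
      congr 2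
      field_simp
      ring
    have hD0 : 0 < D := by rw [hDeq]; positivity
    have hzk : ∀ k, ‖z k‖ ≤ D * (Real.sqrt n * ‖G x *ᵥ z‖) := by
      intro k
      refine (hcol k).trans ?_
      rw [← hGv]
      exact mul_le_mul_of_nonneg_left (norm_toLp_le_sqrt_mul _) hD0.le
    have hz : ‖z‖ ≤ D * (Real.sqrt n * ‖G x *ᵥ z‖) :=
      (pi_norm_le_iff_of_nonneg (by positivity)).2 hzk
    rw [← hDeq, inv_mul_le_iff₀ (by positivity)]
    calc ‖z‖ ≤ D * (Real.sqrt n * ‖G x *ᵥ z‖) := hz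
      _ = D * Real.sqrt n * ‖G x *ᵥ z‖ := by ring

end BookerThorne2014

end Literature.Barriers.RiemannHypothesis
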